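import Summits.QuantumFields.BalabanUV.Beta.SymCorrectorFaceGauge
import Summits.QuantumFields.BalabanUV.Beta.D1BFx.ColumnGaugeNativeFirstOrder

/-!
# `BalabanUV.Beta.D1BFx.ColumnGaugeMergedFirstOrder` — road «BF-x», binder row D1, PART 24 HEAD design (an2 R-D1-g45-3∕-4 (iii)):
# THE (J1) FACE WORDS AND THE (α′) COLUMN-GAUGE WORDS ARE ONE COMMUTATOR — the fully dressed (chart-transported AND bm-dressed) first-order
# vertex of the native spine at level 0 is the STRAIGHT vertex plus `Λ∘𝕄₀ − 𝕄₀∘Λ` with ONE generator `Λ = Λc + Λf` (leaf-03 g30 TT10 ∘ this lineage's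
# `ColumnGaugeNativeFirstOrder`, composed BY NAME; Q-g23-5 of OWNER-MEMO-g23 §1f as a kernel identity)

HONEST DEPENDENCY (cell records, verbatim): «continuum YM on T⁴ ⇐ BetaPertH ∧ nine spine estimates (0/9 proved); BetaPertH ⇐ (D1) ∧ (D4) ∧
CAP+tail; G-an2-4 gates asym, D1 and NE2/3/4.»  HONEST FRAMING (cell contract, verbatim): «discharging `BetaPertH` makes Bałaban's UV stability
UNCONDITIONAL — a real constructive-QFT result; it is NOT the continuum limit and NOT the Clay problem.»  THIS MODULE DISCHARGES NO binder of
row D1 and NO estimate of Bałaban's: one [our object] identity between OUR kernels, composed from leaf-03 g30's `SymCorrectorFaceGauge.vertexOfK_conj_psiKS_eq_add_faceGauge`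
(TT10, p355478 ✓) and `ColumnGaugeNativeFirstOrder.vertexOfK_G0bm_S0NAt_eq_add_comm` under the native spine's pointwise letter `ColumnGaugeGenerator.divV_S0NAt_eq_smul_conjV`.
No `def`, no `def … : Prop`, nothing cited, 0 sorry.  NOT D1, NOT BetaPertH, NOT continuum, NOT Clay.

ABSOLUTE RULE (cell charter, verbatim): «No internally-minted statement may enter as a cited fact. Every hypothesis is either kernel-proved in this
package or a verbatim quotation of a PUBLISHED theorem with page reference.»

THE IDENTITY.  Native spine `S := S0NAt d Lc ρ cE cVH cΛ`, in-block root `ρ = toSite r`, hR hyperplane `2·cVH = −cE·Lc^{d+1}`, road kernel `G₀^{bm} := coDressKBmAt ρ Lc (KInvStep Lc 0)`,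
corrector root offset `r′ ∈ box (d+1) Lc`, `𝕄₀ := bhKAt d ρ Lc`:
`vertexOfK (Ψ̂_{r′}∘G₀^{bm}∘Ψ̂_{r′}ᵀ) Lc S μ y = vertexOfK (KInvStep Lc 0) Lc S μ y + (Λc μ y∘𝕄₀ − 𝕄₀∘Λc μ y) + (Λf μ y∘𝕄₀ − 𝕄₀∘Λf μ y)`
with the COLUMN generator `Λc μ y = diagK (z b ↦ (cE∕2)·χ_{μ,y} (legSite ρ z b))`, `χ_{μ,y} = bmGaugeAt ρ (colH (KInvStep Lc 0) Lc μ y) Lc` and the FACE generator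
`Λf μ y = diagK (z b ↦ −Σ_α Σ_{x ∈ blockSitesF Lc (blk Lc (legSite ρ z b))} colH G₀^{bm} Lc μ y α x·((cE∕2)·faceWt r′ Lc α x))` — BOTH of the `G μ y := Λ μ y∘𝕄 − 𝕄∘Λ μ y`
shape of `ColumnGaugeInvariance.hessKer_columnGauge_of_relInv` against the SAME `𝕄₀` (the road kernel's `RelInv` partner), so their first-order pure-gauge parts cancel
TOGETHER there; what remains of the chart defect at first order is the kernel-leg conjugation (T1) and, for the COMB literal, the displayed `Dsh` word
(`ColumnGaugeCombLetter`).  Side conditions (`Loc`, `axEc`-commutation) are TT10 §5 and `ColumnGaugeNativeFirstOrder` §2 ∕ `ColumnGaugeGenerator` §3.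
Unit `b2b-balaban-beta-d1-p2` gen 23; no existing file touched.
-/

namespace Summit.QuantumFields.BalabanUV.Beta.D1BFx.ColumnGaugeMergedFirstOrder

open Literature.MathematicalPhysics.QuantumFieldTheory
open Literature.MathematicalPhysics.QuantumFieldTheory.LatticeForm (quo)
open Literature.MathematicalPhysics.QuantumFieldTheory.Balaban1983to89
open Literature.MathematicalPhysics.QuantumFieldTheory.Balaban1983to89.Beta
open ExpKernelCalculus (MKer comp)
open AffineAveraging (Site box toSite)
open AveragingContours (blk)
open OneStepResolventKernel (Fib LocStencil)
open OneStepKernelFamily (colH vertexOfK KInvStep)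
open Summit.QuantumFields.BalabanUV.Beta.TameKernelCalculus (trK)
open Summit.QuantumFields.BalabanUV.Beta.AxialDressingRooted (coDressKBmAt spr_coDressKBmAt)
open Summit.QuantumFields.BalabanUV.Beta.AxialProjectorBlockMean (bmGaugeAt)
open Summit.QuantumFields.BalabanUV.Beta.BorderedHessian (diagK bhKAt)
open Summit.QuantumFields.BalabanUV.Beta.AveragingWardRootedStencils (legSite)
open Summit.QuantumFields.BalabanUV.Beta.SpineRooted (S0NAt locStencil_S0NAt)
open Summit.QuantumFields.BalabanUV.Beta.TameKernelCalculus (Spr)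
open Summit.QuantumFields.BalabanUV.Beta.CompositeCorrectorLocality (blockSitesF)
open Summit.QuantumFields.BalabanUV.Beta.SymCorrectorKernel (psiKS)
open Summit.QuantumFields.BalabanUV.Beta.SymCorrectorFace (faceWt)
open Summit.QuantumFields.BalabanUV.Beta.SymCorrectorFaceGauge (vertexOfK_conj_psiKS_eq_add_faceGauge)
open Summit.QuantumFields.BalabanUV.Beta.D1BFx.ColumnGaugeGenerator (divV_S0NAt_eq_smul_conjV)
open Summit.QuantumFields.BalabanUV.Beta.D1BFx.ColumnGaugeNativeFirstOrder (vertexOfK_G0bm_S0NAt_eq_add_comm)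

noncomputable section

variable {d : ℕ} {Lc : ℕ} [NeZero Lc]

/-- **THE FULLY DRESSED FIRST-ORDER VERTEX OF THE NATIVE SPINE = THE STRAIGHT VERTEX + TWO COMMUTATORS WITH `bhKAt`** [our object]
(chart transport by `Ψ̂_{r′}` AND bm column dressing at root `toSite r`, native spine at level 0, hR hyperplane): the (J1) face word and the (α′)
column-gauge word of the chart of record are commutators of the SAME bordered operator with two diagonal generators. -/
theorem vertexOfK_psiKS_G0bm_S0NAt_eq (hLc : 1 ≤ Lc) {r r' : Fin (d + 1) → ℕ} (hr : r ∈ box (d + 1) Lc) (hr' : r' ∈ box (d + 1) Lc)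
    {cE cVH : ℝ} (cΛ : ℝ) (hn : 2 * cVH = -(cE * (Lc : ℝ) ^ (d + 1))) (μ : Fin (d + 1)) (y : Site (d + 1)) :
    vertexOfK (comp (comp (psiKS r' Lc) (coDressKBmAt (toSite r) Lc (KInvStep (d := d) Lc 0))) (trK (psiKS r' Lc))) Lc
        (S0NAt d Lc (toSite r) cE cVH cΛ) μ y
      = vertexOfK (KInvStep (d := d) Lc 0) Lc (S0NAt d Lc (toSite r) cE cVH cΛ) μ y
        + (comp (diagK (fun z b => cE / 2 * bmGaugeAt (toSite r) (colH (KInvStep (d := d) Lc 0) Lc μ y) Lc (legSite (toSite r) z b)))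
              (bhKAt d (toSite r) Lc)
            - comp (bhKAt d (toSite r) Lc)
              (diagK (fun z b => cE / 2 * bmGaugeAt (toSite r) (colH (KInvStep (d := d) Lc 0) Lc μ y) Lc (legSite (toSite r) z b))))
        + (comp (diagK fun z b => -(∑ α : Fin (d + 1), ∑ x ∈ blockSitesF Lc (blk Lc (legSite (toSite r) z b)),
                colH (coDressKBmAt (toSite r) Lc (KInvStep (d := d) Lc 0)) Lc μ y α x * (cE / 2 * faceWt r' Lc α x))) (bhKAt d (toSite r) Lc)
            - comp (bhKAt d (toSite r) Lc) (diagK fun z b => -(∑ α : Fin (d + 1), ∑ x ∈ blockSitesF Lc (blk Lc (legSite (toSite r) z b)),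
                colH (coDressKBmAt (toSite r) Lc (KInvStep (d := d) Lc 0)) Lc μ y α x * (cE / 2 * faceWt r' Lc α x)))) := by
  obtain ⟨Cs, δs, hδs, hS⟩ := locStencil_S0NAt (d := d) hLc hr cE cVH cΛ
  have hK0 : Spr (KInvStep (d := d) Lc 0) := by
    obtain ⟨δ, C, hδ, -, hdec⟩ := OneStepKernelFamily.decays_KInvStep (Lc := Lc) (d := d) 0
    exact ⟨C, δ, hδ, hdec⟩
  have hK := spr_coDressKBmAt hLc hr hK0
  rw [vertexOfK_conj_psiKS_eq_add_faceGauge hLc (fun u => divV_S0NAt_eq_smul_conjV hLc hr cΛ hn u) hr' hK hS hδs μ y,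
    vertexOfK_G0bm_S0NAt_eq_add_comm hLc hr cΛ hn μ y]

end

end Summit.QuantumFields.BalabanUV.Beta.D1BFx.ColumnGaugeMergedFirstOrder
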